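import Literature.AlgebraicGeometry.Morphisms.CechH1ProjectiveFinite
import Literature.AlgebraicGeometry.Morphisms.CechH1Refinement
import HarnessLib

/-!
# `Γ(Z, 𝒪_Z)` is a finitely generated `A`-module for closed subschemes `Z ⊆ 𝐏^r_A`, `A` Noetherian

The degree-zero companion of `Literature/AlgebraicGeometry/Morphisms/CechH1Projective(Finite)` (which
prove that `H^i` of the Čech complex `Č(𝒰, 𝒪_Z)` of a closed subscheme `ι : Z ↪ 𝐏^r_A` on the standard
cover `Z_i = Z ∩ D₊(x_i)` is finitely generated for `i ≥ 1`, Serre's theorem, Hartshorne III Thm. 5.2 (a),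
from the short exact sequence `0 → Č_0(𝔞) → Č_0(P) → Č(𝒰, 𝒪_Z) → 0`, `ProjCech.shortExact_sesZ`):

* `ProjCech.iInf_famP_le_span` — **`H⁰(Č_0(P)) = ⋂_i (P_{x_i})₀` consists of the constants** (inside
  `L = A[x₀^{±1}, …, x_r^{±1}]`: an element of degree `0` lying in every `P[1/x_i]` has only the monomial
  `x^0`; Hartshorne III Thm. 5.1 (a) in degree `0`), hence is finitely generated
  (`moduleFinite_homology_cechP_zero`);
* `ProjCech.moduleFinite_homology_cechZ_zero` — **`H⁰(Č(𝒰, 𝒪_Z))` is finitely generated**, from the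
  segment `H⁰(Č_0(P)) → H⁰(Č(𝒰, 𝒪_Z)) → H¹(Č_0(𝔞))` of the long exact sequence (Mathlib
  `ShortComplex.ShortExact.homology_exact₃`) and Serre's finiteness of `H¹(Č_0(𝔞))`
  (`LaurentCech.moduleFinite_homology_cech`, `Literature/Algebra/Homology/SerreFiniteness`);
* `ProjCech.moduleFinite_sections_top`, `finite_algebraMapΓ_of_isClosedImmersion` — **`Γ(Z, 𝒪_Z)` is a
  finitely generated `A`-module** (Hartshorne III Thm. 5.2 (a) for `𝓕 = 𝒪_Z`, `i = 0`; The Stacks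
  Project, Tag 02O6 for `i = 0` and projective `Z`): `Γ(Z, 𝒪_Z)` embeds into `Ker d⁰ = H⁰(Č(𝒰, 𝒪_Z))`
  by restriction to the `Z_i` (sheaf axiom), and `A` is Noetherian.

This is the degree-`0` input ("`π_* 𝒪_{X'}` is coherent", "`H⁰(X', 𝒪_{X'})` is finite") of the
Chow-lemma step in the proof of the finiteness theorem for proper morphisms (Görtz–Wedhorn II,
Thm. 23.17; The Stacks Project, Tag 02O5), cf. the named fact
`Literature.AlgebraicGeometry.Morphisms.cechH1_finite`. Everything is proved; no named facts are
introduced. Mathlib searched (pin v4.32): `HomologicalComplex.homologyIsoSc'`,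
`ShortComplex.moduleCatHomologyIso`, `ShortComplex.ShortExact.homology_exact₃`,
`Submodule.quotEquivOfEqBot`, `Finsupp.eq_single_iff`, `AddMonoidAlgebra.ext` (used); Mathlib has no
cohomology of projective schemes and no finiteness of global sections of projective schemes.

## References

* R. Hartshorne, *Algebraic Geometry*, GTM 52, Springer (1977): III Thm. 5.1 (a), III Thm. 5.2 (a)
  (p. 228, PDF p. 284). [Hartshorne1977]
* U. Görtz, T. Wedhorn, *Algebraic Geometry II: Cohomology of Schemes*, Springer Spektrum (2023),
  doi:10.1007/978-3-658-43031-3: Thm. 23.17 and its proof, Cor. 23.18, pp. 424–425. [GortzWedhorn2023]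
* The Stacks Project, Tags 02O5, 02O6. [StacksProject]
-/

noncomputable section

open CategoryTheory AlgebraicGeometry TopologicalSpace Opposite
open Literature.Algebra.Homology Literature.Algebra.Homology.LaurentCech Literature.Algebra.Homology.OrderedCech

universe u

namespace Literature.AlgebraicGeometry.Morphisms

namespace ProjCech

variable {A : Type u} [CommRing A] {r : ℕ}

/-! ### `H⁰` of the degree-`0` Čech complex of `P = A[x₀, …, x_r]`: the constants -/

/-- The coefficients of (each coordinate of) a vector of `P^J[1/X_s]`, realised inside `L^J`, vanish at
exponent vectors with a negative entry outside `s`. [folklore] -/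
theorem coeff_apply_eq_zero_of_mem_loc_top {J : Type} {v : J → L A r} {s : Finset (Fin (r + 1))}
    (hv : v ∈ loc (⊤ : Submodule (P A r) (J → P A r)) s) (j : J) {m : Expt r}
    (hm : ∃ k, k ∉ s ∧ m k < 0) : (v j).coeff m = 0 := by
  obtain ⟨N, k, -, hk⟩ := hv
  have h1 : xs A s N * v j = toL A r (k j) := by
    have := congr_fun hk j
    rwa [Pi.smul_apply, smul_eq_mul, ιK_apply] at this
  have h2 : (xs A s N * v j).coeff (sx r s N + m) = (v j).coeff m := by
    rw [xs, coeff_single_mul, one_mul, add_sub_cancel_left]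
  obtain ⟨k₀, hk₀s, hk₀⟩ := hm
  rw [← h2, h1]
  exact coeff_toL_eq_zero (k j) ⟨k₀, by rwa [Pi.add_apply, sx_apply, if_neg hk₀s, zero_add]⟩

/-- A vector of `⋂_i (P_{x_i})₀ ⊆ L^{pt}` has only the constant monomial: its coefficients vanish at
every exponent `m ≠ 0` (for `r ≥ 1` every entry of `m` is `≥ 0` — use a chart `x_i` with `i` different
from the entry — and the total degree is `0`; for `r = 0` the total degree is the only entry).
[cite: Hartshorne1977, III Thm. 5.1 (a) p. 225] -/
theorem coeff_eq_zero_of_mem_iInf_famP {v : Unit → L A r} (hv : v ∈ ⨅ i, famP A r {i}) {m : Expt r}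
    (hm : m ≠ 0) : (v ()).coeff m = 0 := by
  by_contra hne
  have hvi : ∀ i, v ∈ famP A r {i} := (Submodule.mem_iInf _).mp hv
  -- total degree `0`
  have hdeg : edeg r m = 0 := by
    have h := ((mem_Kdeg (0 : Unit → ℤ)).mp (hvi 0).2) ()
    rw [Pi.zero_apply, sub_zero] at h
    exact (mem_Ldeg.mp h) m hne
  -- every entry is non-negative
  have hnonneg : ∀ j, 0 ≤ m j := by
    intro j
    by_cases h : ∃ i : Fin (r + 1), i ≠ j
    · obtain ⟨i, hij⟩ := h
      by_contra hlt
      exact hne (coeff_apply_eq_zero_of_mem_loc_top (hvi i).1 ()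
        ⟨j, Finset.notMem_singleton.mpr hij.symm, not_le.mp hlt⟩)
    · push Not at h
      rw [edeg_apply, Finset.sum_eq_single j (fun i _ hi => absurd (h i) hi)
        (fun hj => absurd (Finset.mem_univ j) hj)] at hdeg
      exact hdeg.ge
  -- a non-negative vector with zero sum vanishes
  apply hm
  funext i
  rw [edeg_apply] at hdeg
  exact (Finset.sum_eq_zero_iff_of_nonneg fun i _ => hnonneg i).mp hdeg i (Finset.mem_univ i)

/-- **`H⁰(Č_0(P)) = ⋂_i (P_{x_i})₀` is contained in the constants `A · 1`.**
[cite: Hartshorne1977, III Thm. 5.1 (a) p. 225] -/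
theorem iInf_famP_le_span :
    (⨅ i, famP A r {i}) ≤ Submodule.span A {fun _ : Unit => (1 : L A r)} := by
  intro v hv
  rw [Submodule.mem_span_singleton]
  refine ⟨(v ()).coeff 0, funext fun u => ?_⟩
  cases u
  rw [Pi.smul_apply]
  apply AddMonoidAlgebra.ext
  rw [AddMonoidAlgebra.coeff_smul, AddMonoidAlgebra.one_def, AddMonoidAlgebra.coeff_single,
    Finsupp.smul_single, smul_eq_mul, mul_one, eq_comm, Finsupp.eq_single_iff]
  refine ⟨fun m hm => ?_, rfl⟩
  rw [Finset.mem_singleton]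
  by_contra hm0
  exact (Finsupp.mem_support_iff.mp hm) (coeff_eq_zero_of_mem_iInf_famP hv hm0)

/-- Hence `⋂_i (P_{x_i})₀` is a finitely generated `A`-module (`A` Noetherian). [folklore] -/
theorem moduleFinite_iInf_famP [IsNoetherianRing A] : Module.Finite A ↥(⨅ i, famP A r {i}) := by
  haveI : IsNoetherian A ↥(Submodule.span A {fun _ : Unit => (1 : L A r)}) :=
    isNoetherian_of_isNoetherianRing_of_finite A _
  exact Module.Finite.of_injective (Submodule.inclusion iInf_famP_le_span)
    (Submodule.inclusion_injective _)

/-- **`H⁰(Č_0(P))` is a finitely generated `A`-module** (it is `Ker d⁰ ≅ ⋂_i (P_{x_i})₀ = A`,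
`OrderedCech.kerDZeroEquiv`), `Č_0(P) = cech 0 ⊤ 0` being the degree-`0` Čech complex of the free
module of rank one (the middle term of `ProjCech.sesZ`). [cite: Hartshorne1977, III Thm. 5.1 (a) p. 225] -/
theorem moduleFinite_homology_cechP_zero [IsNoetherianRing A] :
    Module.Finite A ((cech (0 : Unit → ℤ) (⊤ : Submodule (P A r) (Unit → P A r)) 0).homology 0) := by
  set C := cech (0 : Unit → ℤ) (⊤ : Submodule (P A r) (Unit → P A r)) 0
  have hg : (C.sc' (-1) 0 1).g = ModuleCat.ofHom (OrderedCech.d (famP A r) (locDeg_mono _ _ 0) 0) :=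
    OrderedCech.complex_d (famP A r) (locDeg_mono _ _ 0) 0
  haveI : Module.Finite A (LinearMap.ker (C.sc' (-1) 0 1).g.hom) := by
    rw [hg]
    haveI := moduleFinite_iInf_famP (A := A) (r := r)
    exact Module.Finite.equiv (kerDZeroEquiv (famP A r) (locDeg_mono _ _ 0)).symm
  haveI : Module.Finite A (C.sc' (-1) 0 1).moduleCatLeftHomologyData.H := by
    rw [ShortComplex.moduleCatLeftHomologyData_H]
    infer_instance
  exact Module.Finite.equiv
    (C.homologyIsoSc' (-1) 0 1 (by simp) (by simp) ≪≫ (C.sc' (-1) 0 1).moduleCatHomologyIso).toLinearEquiv.symm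

/-! ### `H⁰(Č(𝒰, 𝒪_Z))` and `Γ(Z, 𝒪_Z)` -/

variable {Z : Scheme.{u}} (ι : Z ⟶ PP A r)

variable [IsClosedImmersion ι]

/-- **`H⁰(Č(𝒰, 𝒪_Z))` is a finitely generated `A`-module** for a closed subscheme `Z ⊆ 𝐏^r_A` over a
Noetherian ring: the segment `H⁰(Č_0(P)) → H⁰(Č(𝒰, 𝒪_Z)) → H¹(Č_0(𝔞))` of the long exact sequence of
`0 → Č_0(𝔞) → Č_0(P) → Č(𝒰, 𝒪_Z) → 0` has finitely generated outer terms
(`moduleFinite_homology_cechP_zero`; Serre, `LaurentCech.moduleFinite_homology_cech`).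
[cite: Hartshorne1977, III Thm. 5.2 (a) p. 228 (PDF p. 284)] -/
theorem moduleFinite_homology_cechZ_zero [IsNoetherianRing A] :
    Module.Finite A ((cechZ ι).homology 0) := by
  have hex := (shortExact_sesZ ι).homology_exact₃ 0 1 (by simp)
  haveI : Module.Finite A ((sesZ ι).X₂.homology 0) := moduleFinite_homology_cechP_zero
  haveI : Module.Finite A ((sesZ ι).X₁.homology 1) :=
    moduleFinite_homology_cech (0 : Unit → ℤ) (isGraded_KZ ι) 0 1 le_rfl
  exact moduleFinite_X₂_of_exact _ hex

/-- **The Čech `0`-cocycles `Ker d⁰ ⊆ Q⁰` form a finitely generated `A`-module** (`= H⁰(Č(𝒰, 𝒪_Z))`: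
there are no `(-1)`-simplices, so there are no boundaries in degree `0`). [folklore] -/
theorem moduleFinite_ker_dQ_zero [IsNoetherianRing A] : Module.Finite A (LinearMap.ker (dQ ι 0)) := by
  haveI : Module.Finite A ((cechZ ι).homology 0) := moduleFinite_homology_cechZ_zero ι
  -- the short complex `Q⁻¹ → Q⁰ → Q¹`; its second map is `dQ 0`
  have hg : ((cechZ ι).sc' (-1) 0 1).g = ModuleCat.ofHom (dQ ι 0) := cechZ_d ι 0
  have e : (cechZ ι).homology 0 ≅ ((cechZ ι).sc' (-1) 0 1).moduleCatLeftHomologyData.H :=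
    (cechZ ι).homologyIsoSc' (-1) 0 1 (by simp) (by simp) ≪≫ ((cechZ ι).sc' (-1) 0 1).moduleCatHomologyIso
  have hfin : Module.Finite A ((cechZ ι).sc' (-1) 0 1).moduleCatLeftHomologyData.H :=
    Module.Finite.equiv e.toLinearEquiv
  -- `Q⁻¹ = 0`, so the boundaries vanish
  have hbot : LinearMap.range ((cechZ ι).sc' (-1) 0 1).moduleCatToCycles = ⊥ := by
    haveI := OrderedCech.isEmpty_simplex_of_neg (ι := Fin (r + 1)) (n := -1) (by norm_num)
    rw [LinearMap.range_eq_bot]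
    ext x
    have hx : x = 0 := Subsingleton.elim (α := QX ι (-1)) x 0
    rw [hx, map_zero, LinearMap.zero_apply]
  rw [ShortComplex.moduleCatLeftHomologyData_H, hbot] at hfin
  haveI : Module.Finite A (LinearMap.ker ((cechZ ι).sc' (-1) 0 1).g.hom ⧸
      (⊥ : Submodule A (LinearMap.ker ((cechZ ι).sc' (-1) 0 1).g.hom))) := hfin
  have h := Module.Finite.equiv
    (Submodule.quotEquivOfEqBot (⊥ : Submodule A (LinearMap.ker ((cechZ ι).sc' (-1) 0 1).g.hom)) rfl)
  rwa [hg] at h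

/-- **`Γ(Z, 𝒪_Z)` is a finitely generated `A`-module for a closed subscheme `ι : Z ↪ 𝐏^r_A` over a
Noetherian ring `A`** (Hartshorne III Thm. 5.2 (a) for `𝓕 = 𝒪_Z` and `i = 0`; here `Γ(Z, 𝒪_Z)` is the
`A`-module `Sections (Z → 𝐏^r_A → Spec A) ⊤`): restriction to the members `Z_i` of the standard cover
embeds `Γ(Z, 𝒪_Z)` `A`-linearly into the Čech `0`-cocycles (locality of the sheaf `𝒪_Z`), which are
finitely generated (`moduleFinite_ker_dQ_zero`). [cite: Hartshorne1977, III Thm. 5.2 (a) p. 228 (PDF p. 284)] -/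
theorem moduleFinite_sections_top [IsNoetherianRing A] : Module.Finite A (Sections (strZ ι) ⊤) := by
  haveI := moduleFinite_ker_dQ_zero ι
  haveI : IsNoetherian A (LinearMap.ker (dQ ι 0)) := isNoetherian_of_isNoetherianRing_of_finite A _
  -- restriction to the `Z_σ`, `σ` a `0`-simplex
  let ρ : Sections (strZ ι) ⊤ →ₗ[A] QX ι 0 :=
    LinearMap.pi fun σ => (Sections.res (strZ ι) (le_top : Zop ι σ.1 ≤ ⊤)).toLinearMap
  have hρ : ∀ s σ, ρ s σ = Sections.res (strZ ι) le_top s := fun _ _ => rfl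
  -- global sections restrict to cocycles
  have hZ : ∀ s, dQ ι 0 (ρ s) = 0 := by
    intro s
    funext σ
    obtain ⟨a, b, hab, rfl⟩ := exists_eq_edge σ
    rw [dQ_edge, hρ, hρ, Sections.res_res, Sections.res_res]
    exact sub_self _
  -- and injectively (the `Z_i` cover `Z`)
  have hinj : Function.Injective ρ := by
    rw [injective_iff_map_eq_zero]
    intro s hs
    apply Sections.eq_of_res_eq (strZ ι) (cover ι) (fun i => le_top) (by rw [iSup_cover_eq_top ι])
    intro i
    have h := congr_fun hs (vertex i)
    rw [hρ, Pi.zero_apply] at h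
    rw [map_zero]
    exact h
  exact Module.Finite.of_injective (LinearMap.codRestrict _ ρ fun s => LinearMap.mem_ker.mpr (hZ s))
    fun s t h => hinj (congrArg Subtype.val h)

end ProjCech

section Projective

variable {A : Type u} [CommRing A] {Z : Scheme.{u}} (g : Z ⟶ Spec (.of A)) {r : ℕ}
  (ι : Z ⟶ ProjCech.PP A r) [IsClosedImmersion ι] (hg : ι ≫ ProjCech.toSpec A r = g)

include hg

/-- `Γ(Z, 𝒪_Z)` (`= Sections g ⊤`) is a finitely generated `A`-module for an `A`-scheme `g : Z → Spec A`,
`A` Noetherian, admitting a closed `A`-immersion into some `𝐏^r_A`.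
[cite: Hartshorne1977, III Thm. 5.2 (a) p. 228 (PDF p. 284)] -/
theorem moduleFinite_sections_top_of_isClosedImmersion [IsNoetherianRing A] :
    Module.Finite A (Sections g ⊤) := by
  subst hg
  exact ProjCech.moduleFinite_sections_top ι

/-- Equivalently: the structure map `A → Γ(Z, 𝒪_Z)` (`algebraMapΓ g`) of a projective `A`-scheme over a
Noetherian ring is a finite ring homomorphism. [cite: Hartshorne1977, III Thm. 5.2 (a) p. 228 (PDF p. 284)] -/
theorem finite_algebraMapΓ_of_isClosedImmersion [IsNoetherianRing A] : (algebraMapΓ g).Finite := by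
  have h1 : ((Z.presheaf.map (homOfLE (le_top : (⊤ : Z.Opens) ≤ ⊤)).op).hom.comp
      (algebraMapΓ g)).Finite :=
    moduleFinite_sections_top_of_isClosedImmersion g ι hg
  have h2 : (Z.presheaf.map (homOfLE (le_top : (⊤ : Z.Opens) ≤ ⊤)).op).hom.comp (algebraMapΓ g) =
      algebraMapΓ g := by
    have : (homOfLE (le_top : (⊤ : Z.Opens) ≤ ⊤)).op = 𝟙 (op ⊤) := Subsingleton.elim _ _
    rw [this, Z.presheaf.map_id]
    rfl
  rwa [h2] at h1

end Projective

end Literature.AlgebraicGeometry.Morphisms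

end
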